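import Summits.BirchSwinnertonDyer.BirchSwinnertonDyer.Theorems.PrintX8VerticalStevensBridge
import HarnessLib

/-!
# Route `PrintX8`, cruxes 20622 / 20714 — generic Stevens bridge, part 1: Hecke-term elements with their
# exact `Γ₁(N)`-classes, and the degenerate test element

Cell `bsd-print-x8`, seat p1 (gen 4), `--supports stmt-BirchSwinnertonDyer-20622`.  Theorems only.  Refines the
elements of `PrintX8VerticalStevensPeriods` for the GENERIC bridge (`PrintX8VerticalStevensBridgeBy`): the terms
`(a + jc)/(pc)` and `pa/c` of the Hecke relation at `x = γ∞` are cusps `δ∞` with `d(δγ⁻¹) mod N` EXACTLY `1`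
(generic `j`; `δγ⁻¹ ∈ Γ₁(N)`), `p` (the one `j` with `p ∣ a + jc`), `p^{φ(N)−1}` (`pa/c`, `p ∤ c`) or `1` (`pa/c`,
`p ∣ c`) — so that only `Γ₁(N)`-invariance of the reduced period functional is needed (no `Γ_H(N)`); and a test
element with `d = 0` (possible only for `N = 1`) has period `0` (`{∞, γ∞} = {∞, 0} = {∞, S∞}`, `S` of order `4`).
-/

-- the summit namespace repeats `BirchSwinnertonDyer` by design (summit = problem); linter moot
set_option linter.dupNamespace false
set_option autoImplicit false

noncomputable section

namespace Summit.BirchSwinnertonDyer.BirchSwinnertonDyer.Theorems.PrintX8VerticalStevens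

open scoped MatrixGroups ModularForm

open CongruenceSubgroup Matrix Matrix.SpecialLinearGroup
  Literature.NumberTheory.EllipticCurves Literature.NumberTheory.EllipticCurves.ModularForms
  Literature.NumberTheory.EllipticCurves.Rank1Residual

section HeckeTerms

variable {N : ℕ} {p : ℕ} [Fact p.Prime]

/-- `d(δγ⁻¹) mod N = x · a_γ` for `δ = (∗ ∗; w x)` with `N ∣ w`. -/
theorem gamma0Map_mul_inv_eq {δ γ : Gamma0 N} {x : ℤ}
    (hw : (((δ : SL(2, ℤ)) 1 0 : ℤ) : ZMod N) = 0) (hx : ((δ : SL(2, ℤ)) 1 1 : ℤ) = x) :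
    Gamma0Map N (δ * γ⁻¹) = ((x * ((γ : SL(2, ℤ)) 0 0 : ℤ) : ℤ) : ZMod N) := by
  rw [← intCast_dEntry, dEntry_mul_inv, ← hx]
  push_cast
  rw [hw, zero_mul, zero_add]

/-- **Hecke term `(a + jc)/(pc)` as `δ∞`, with the exact class of `δγ⁻¹`**: `d(δγ⁻¹) ≡ 1 (mod N)` if
`p ∤ a + jc` (then `δγ⁻¹ ∈ Γ₁(N)`), and `≡ p` if `p ∣ a + jc`. -/
theorem exists_heckeTerm_gamma1 (γ : Gamma0 N) (hc : ((γ : SL(2, ℤ)) 1 0 : ℤ) ≠ 0) (j : ℤ) :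
    ∃ δ : Gamma0 N, ((δ : SL(2, ℤ)) 1 0 : ℤ) ≠ 0 ∧
      (((δ : SL(2, ℤ)) 0 0 : ℤ) : ℚ) / (((δ : SL(2, ℤ)) 1 0 : ℤ) : ℚ) =
        ((((γ : SL(2, ℤ)) 0 0 : ℤ) : ℚ) + j * ((γ : SL(2, ℤ)) 1 0 : ℤ)) /
          ((p : ℚ) * ((γ : SL(2, ℤ)) 1 0 : ℤ)) ∧
      (¬ (p : ℤ) ∣ ((γ : SL(2, ℤ)) 0 0 : ℤ) + j * ((γ : SL(2, ℤ)) 1 0 : ℤ) → δ * γ⁻¹ ∈ Gamma1' N) ∧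
      ((p : ℤ) ∣ ((γ : SL(2, ℤ)) 0 0 : ℤ) + j * ((γ : SL(2, ℤ)) 1 0 : ℤ) →
        Gamma0Map N (δ * γ⁻¹) = (p : ZMod N)) := by
  have hp : p.Prime := Fact.out
  set a : ℤ := (γ : SL(2, ℤ)) 0 0 with ha
  set b : ℤ := (γ : SL(2, ℤ)) 0 1 with hb
  set c : ℤ := (γ : SL(2, ℤ)) 1 0 with hc'
  set d : ℤ := (γ : SL(2, ℤ)) 1 1 with hd
  have hdet : a * d - b * c = 1 := by
    have := Matrix.SpecialLinearGroup.det_coe (γ : SL(2, ℤ))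
    rw [Matrix.det_fin_two] at this
    rw [ha, hb, hc', hd]; linear_combination this
  have hac : IsCoprime a c := ⟨d, -b, by linear_combination hdet⟩
  have hcN : ((c : ℤ) : ZMod N) = 0 := by
    have := Gamma0_mem.mp γ.2
    rwa [hc']
  have hajc : IsCoprime (a + j * c) c := by
    simpa [add_comm, mul_comm] using hac.add_mul_left_left j
  have hpZ : Prime (p : ℤ) := Nat.prime_iff_prime_int.mp hp
  have hcQ : (c : ℚ) ≠ 0 := by exact_mod_cast hc
  have hpQ : (p : ℚ) ≠ 0 := by exact_mod_cast hp.ne_zero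
  by_cases hdiv : (p : ℤ) ∣ a + j * c
  · obtain ⟨u, hu⟩ := hdiv
    have huc : IsCoprime u c := by
      rw [hu] at hajc
      exact hajc.of_mul_left_right
    obtain ⟨δ, x, h00, h10, h11, hxu⟩ := exists_gamma0_of_isCoprime (N := N) huc hcN
    refine ⟨δ, by rw [h10]; exact hc, ?_, fun hnd ↦ (hnd ⟨u, hu⟩).elim, fun _ ↦ ?_⟩
    · rw [h00, h10]
      have huQ : (a : ℚ) + j * c = p * u := by exact_mod_cast hu
      rw [huQ]
      field_simp
    · rw [gamma0Map_mul_inv_eq (by rw [h10]; exact hcN) h11, ← ha]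
      have h2 : x * a = p * (x * u) - x * j * c := by linear_combination x * hu
      rw [h2]
      push_cast at hxu ⊢
      rw [hcN]
      linear_combination (p : ZMod N) * hxu
  · have hcop : IsCoprime (a + j * c) (p * c) :=
      IsCoprime.mul_right ((Prime.coprime_iff_not_dvd hpZ).mpr hdiv).symm hajc
    have hpcN : ((p * c : ℤ) : ZMod N) = 0 := by push_cast; rw [hcN, mul_zero]
    obtain ⟨δ, x, h00, h10, h11, hxu⟩ := exists_gamma0_of_isCoprime (N := N) hcop hpcN
    refine ⟨δ, ?_, ?_, fun _ ↦ ?_, fun hd' ↦ (hdiv hd').elim⟩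
    · rw [h10]; exact mul_ne_zero (by exact_mod_cast hp.ne_zero) hc
    · rw [h00, h10]; push_cast; ring
    · rw [Gamma1_mem', gamma0Map_mul_inv_eq (by rw [h10]; exact hpcN) h11, ← ha]
      have h2 : x * a = x * (a + j * c) - x * j * c := by ring
      rw [h2]
      push_cast at hxu ⊢
      rw [hcN] at hxu ⊢
      linear_combination hxu

variable [NeZero N]

/-- **Hecke term `pa/c` as `δ∞`, with the exact class of `δγ⁻¹`**: `δγ⁻¹ ∈ Γ₁(N)` if `p ∣ c`, and
`d(δγ⁻¹) ≡ p^{φ(N)−1} = p⁻¹` if `p ∤ c`. -/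
theorem exists_heckeTerm'_gamma1 (hpN : ¬ p ∣ N) (γ : Gamma0 N) (hc : ((γ : SL(2, ℤ)) 1 0 : ℤ) ≠ 0) :
    ∃ δ : Gamma0 N, ((δ : SL(2, ℤ)) 1 0 : ℤ) ≠ 0 ∧
      (((δ : SL(2, ℤ)) 0 0 : ℤ) : ℚ) / (((δ : SL(2, ℤ)) 1 0 : ℤ) : ℚ) =
        (p : ℚ) * ((((γ : SL(2, ℤ)) 0 0 : ℤ) : ℚ) / ((γ : SL(2, ℤ)) 1 0 : ℤ)) ∧
      ((p : ℤ) ∣ ((γ : SL(2, ℤ)) 1 0 : ℤ) → δ * γ⁻¹ ∈ Gamma1' N) ∧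
      (¬ (p : ℤ) ∣ ((γ : SL(2, ℤ)) 1 0 : ℤ) →
        Gamma0Map N (δ * γ⁻¹) = (p : ZMod N) ^ (Nat.totient N - 1)) := by
  have hp : p.Prime := Fact.out
  set a : ℤ := (γ : SL(2, ℤ)) 0 0 with ha
  set b : ℤ := (γ : SL(2, ℤ)) 0 1 with hb
  set c : ℤ := (γ : SL(2, ℤ)) 1 0 with hc'
  set d : ℤ := (γ : SL(2, ℤ)) 1 1 with hd
  have hdet : a * d - b * c = 1 := by
    have := Matrix.SpecialLinearGroup.det_coe (γ : SL(2, ℤ))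
    rw [Matrix.det_fin_two] at this
    rw [ha, hb, hc', hd]; linear_combination this
  have hac : IsCoprime a c := ⟨d, -b, by linear_combination hdet⟩
  have hcN : ((c : ℤ) : ZMod N) = 0 := by
    have := Gamma0_mem.mp γ.2
    rwa [hc']
  have hpZ : Prime (p : ℤ) := Nat.prime_iff_prime_int.mp hp
  have hcQ : (c : ℚ) ≠ 0 := by exact_mod_cast hc
  have hpQ : (p : ℚ) ≠ 0 := by exact_mod_cast hp.ne_zero
  have hNp : IsCoprime (N : ℤ) (p : ℤ) :=
    Nat.isCoprime_iff_coprime.mpr ((Nat.Prime.coprime_iff_not_dvd hp).mpr hpN).symm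
  by_cases hdiv : (p : ℤ) ∣ c
  · obtain ⟨c₁, hc₁⟩ := hdiv
    have hac₁ : IsCoprime a c₁ := by
      rw [hc₁] at hac
      exact hac.of_mul_right_right
    have hc₁N : ((c₁ : ℤ) : ZMod N) = 0 := by
      rw [ZMod.intCast_zmod_eq_zero_iff_dvd] at hcN ⊢
      rw [hc₁] at hcN
      exact hNp.dvd_of_dvd_mul_left hcN
    have hc₁0 : c₁ ≠ 0 := by rintro rfl; exact hc (by simpa using hc₁)
    obtain ⟨δ, x, h00, h10, h11, hxu⟩ := exists_gamma0_of_isCoprime (N := N) hac₁ hc₁N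
    refine ⟨δ, by rw [h10]; exact hc₁0, ?_, fun _ ↦ ?_, fun hnd ↦ (hnd ⟨c₁, hc₁⟩).elim⟩
    · rw [h00, h10]
      have : (c : ℚ) = p * c₁ := by exact_mod_cast hc₁
      rw [this]
      have hc₁Q : (c₁ : ℚ) ≠ 0 := by exact_mod_cast hc₁0
      field_simp
    · rw [Gamma1_mem', gamma0Map_mul_inv_eq (by rw [h10]; exact hc₁N) h11, ← ha]
      exact hxu
  · have hcop : IsCoprime (p * a) c :=
      IsCoprime.mul_left ((Prime.coprime_iff_not_dvd hpZ).mpr hdiv) hac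
    obtain ⟨δ, x, h00, h10, h11, hxu⟩ := exists_gamma0_of_isCoprime (N := N) hcop hcN
    refine ⟨δ, by rw [h10]; exact hc, ?_, fun hd' ↦ (hdiv hd').elim, fun _ ↦ ?_⟩
    · rw [h00, h10]; push_cast; ring
    · rw [gamma0Map_mul_inv_eq (by rw [h10]; exact hcN) h11, ← ha]
      have key := pow_totient_sub_one_mul_self (N := N) (p := p) hpN
      push_cast at hxu ⊢
      calc (x : ZMod N) * a = (x * a) * ((p : ZMod N) ^ (Nat.totient N - 1) * p) := by rw [key, mul_one]
        _ = (x * (p * a)) * (p : ZMod N) ^ (Nat.totient N - 1) := by ring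
        _ = (p : ZMod N) ^ (Nat.totient N - 1) := by rw [hxu, one_mul]

end HeckeTerms

section Degenerate

variable {N : ℕ} [NeZero N] (f : CuspForm (Gamma0 N) 2)

/-- The degenerate test element: if `γ = (a b; c d) ∈ Γ₀(N)` has `d = 0` then `c = ±1`, `N = 1`, `S ∈ Γ₀(N)`
has order `4`, and `{∞, γ∞}_f = {∞, ±a}_f = {∞, 0}_f = {∞, S∞}_f = 0`. -/
theorem cuspSymbol_eq_zero_of_apply_one_one_eq_zero (γ : Gamma0 N) (hd : ((γ : SL(2, ℤ)) 1 1 : ℤ) = 0) :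
    cuspSymbol f γ = 0 := by
  set a : ℤ := (γ : SL(2, ℤ)) 0 0 with ha
  set b : ℤ := (γ : SL(2, ℤ)) 0 1 with hb
  set c : ℤ := (γ : SL(2, ℤ)) 1 0 with hc
  have hdet : a * 0 - b * c = 1 := by
    have := Matrix.SpecialLinearGroup.det_coe (γ : SL(2, ℤ))
    rw [Matrix.det_fin_two] at this
    rw [ha, hb, hc, ← hd]; linear_combination this
  have hcb : c * (-b) = 1 := by linear_combination hdet
  have hc1 : c = 1 ∨ c = -1 := Int.eq_one_or_neg_one_of_mul_eq_one hcb
  have hcN : ((c : ℤ) : ZMod N) = 0 := by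
    have := Gamma0_mem.mp γ.2
    rwa [hc]
  have h1N : ((1 : ℤ) : ZMod N) = 0 := by
    rcases hc1 with h | h
    · rwa [h] at hcN
    · rw [h, Int.cast_neg, neg_eq_zero] at hcN; exact hcN
  -- `S ∈ Γ₀(N)` (as `N = 1`), of order `4`
  have hSmem : ModularGroup.S ∈ Gamma0 N := Gamma0_mem.mpr (by simpa [ModularGroup.coe_S] using h1N)
  set Sg : Gamma0 N := ⟨ModularGroup.S, hSmem⟩ with hSg
  have hSfin : IsOfFinOrder Sg := by
    refine isOfFinOrder_iff_pow_eq_one.mpr ⟨4, by norm_num, ?_⟩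
    ext i j
    rw [hSg]
    fin_cases i <;> fin_cases j <;>
      simp [pow_succ, ModularGroup.coe_S, Matrix.mul_apply, Fin.sum_univ_two]
  have hS0 : cuspSymbol f Sg = 0 := cuspSymbol_eq_zero_of_isOfFinOrder f hSfin
  have hS0' : cuspSymbol f Sg = modularSymbol f 0 := by
    rw [cuspSymbol, hSg, if_neg (by simp [ModularGroup.coe_S])]
    simp [ModularGroup.coe_S]
  have hc0 : c ≠ 0 := by rcases hc1 with h | h <;> rw [h] <;> norm_num
  rw [cuspSymbol, if_neg (by rw [← hc]; exact hc0), ← hS0, hS0', ← ha, ← hc]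
  rcases hc1 with h | h
  · rw [h, Int.cast_one, div_one]
    have := modularSymbol_add_intCast_holds f 0 a
    simp only [zero_add] at this
    exact this
  · rw [h, Int.cast_neg, Int.cast_one, div_neg, div_one]
    have := modularSymbol_add_intCast_holds f 0 (-a)
    simp only [zero_add, Int.cast_neg] at this
    exact this

end Degenerate

end Summit.BirchSwinnertonDyer.BirchSwinnertonDyer.Theorems.PrintX8VerticalStevens

end
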